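import Mathlib
import HarnessLib
import Literature.Analysis.FluidPDE.SuitableWeak
import Literature.Analysis.FluidPDE.SelfSimilar
import Literature.Analysis.FluidPDE.LocalTypeI
import Literature.Analysis.FluidPDE.ESSLocalHolderNoConcentration
import Summits.NavierStokesRegularity.NavierStokesRegularity.Theorems.RellichScarNoMildScar

/-!
# Blow-up at the origin in the rate class on a cone (line calm-cone-carleman, crux ApexLocalisation stmt-NavierStokesRegularity-11719, stub `stub_coneZoomLimit`)

Step S1c (cone widening) of the line `calm-cone-carleman`: the half-space step S1
(`stub_halfspaceZoomLimit`) with the half-space `{x | 0 < ⟪x, e⟫}` replaced everywhere by the open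
cone `{x | κ ‖x‖ < ⟪x, e⟫}` (`κ : ℝ` arbitrary).  Let `(u, p)` be a suitable weak solution of
Navier–Stokes (`ν = 1`, `f = 0`) on the backward slab `(-∞, 0) × ℝ³` with a weak gradient `G`,
Albritton–Barker quantity `𝐈 < ∞`, the RATE bound `‖u(t, x)‖ ≤ C/√(−t)`, a backward-singular
origin, and which on the cone is apex-CALM (`‖u(t, x)‖ ≤ K/(‖x‖ + √(−t))`) and scar-FAINT
(`‖x‖ ‖u(t, x)‖ ≤ ε` for `‖x‖ < δ(ε)`, `−η(ε)‖x‖² < t < 0`).  Zooming in at the space–time origin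
along the dyadic scales `λ = 2^{-(k+1)}` (`u_λ(s, y) = λ u(λ² s, λ y)`; covariance lemmas of
`RellichScarNoMildScarZoom`) and running the tree's ENGINE `slab_typeI_compactness`
(Albritton–Barker 2019, Lemma 2.2 + Prop. 2.3 + §3) produces a subsequence converging in
`L³(Q(0, R))` for every `R > 0` to a suitable weak solution `(w, π)` on the slab with a weak
gradient `H`, `𝐈(w, π, H) ≤ 4 𝐈(u) < ∞` and a backward-singular origin (every zoom is singular
at the origin).  The cone predicate, the rate and the calm bounds are scale invariant, and the
faint bound of the zoom at scale `λ` holds on the larger region `‖y‖ < δ/λ`; all three pass to the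
almost-everywhere limit along an a.e. convergent subsequence on each `Q(0, n + 1)` (convergence in
measure), the faint one in the limit form `‖y‖ ‖w(s, y)‖ ≤ ε` on
`{κ ‖y‖ < ⟪y, e⟫, −η(ε)‖y‖² < s < 0}`.

Template: `stub_halfspaceZoomLimit` (`RellichScarApexLocalisationHalfspaceZoomLimit`), itself
modelled on `RellichScarNoMildScar.exists_blowup_limit_apex`.

* `coneZoom_ae_limit_bound` — pointwise bounds of an `L³_loc`-convergent sequence pass to the
  a.e. limit;
* `coneZoom_mem_cone_smul_iff` — the cone predicate is invariant under positive dilations;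
* `coneZoom_rate`, `coneZoom_calm`, `coneZoom_faint` — the three bounds under the zoom;
* `stub_coneZoomLimit` — the statement S1c.

Reference: D. Albritton, T. Barker, *On local Type I singularities of the Navier–Stokes equations
and Liouville theorems*, J. Math. Fluid Mech. 21 (2019) = arXiv:1811.00502, Lemma 2.2, Prop. 2.3, §3.
-/

noncomputable section

set_option linter.dupNamespace false

namespace Summit.NavierStokesRegularity.NavierStokesRegularity.Theorems.RellichScarApexLocalisation

open MeasureTheory Set Function Metric Filter Topology TopologicalSpace
open scoped ENNReal NNReal InnerProductSpace RealInnerProductSpace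
open Literature.Analysis Literature.Analysis.FluidPDE
open Summit.NavierStokesRegularity.NavierStokesRegularity.Theorems.RellichScarNoMildScar

local notation "E³" => EuclideanSpace ℝ (Fin 3)

/-- The open backward slab `(-∞, 0) × ℝ³` (time first). -/
local notation "𝕊" => Literature.Analysis.FluidPDE.slab (EuclideanSpace ℝ (Fin 3)) (Set.Iio (0 : ℝ)) isOpen_Iio

/-! ### Pointwise bounds pass to the a.e. limit of an `L³_loc`-convergent sequence -/

/-- **Pointwise bounds pass to the a.e. limit.**  If measurable fields `v_j` on the backward slab
converge to `w` in `L³(Q(0, R))` for every `R > 0`, and at every point `z` of the slab satisfying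
`P` the bound `f_z(v_j(z)) ≤ b(z)` holds for all large `j` (`f_z` continuous), then
`f_z(w(z)) ≤ b(z)` for a.e. `z` in the slab satisfying `P`: on each `Q(0, n + 1)` the sequence
converges in measure, hence a.e. along a subsequence, and the balls `Q(0, n + 1)` exhaust the slab
(adapted from `halfspaceZoom_ae_limit_bound`). [folklore] -/
private theorem coneZoom_ae_limit_bound {v : ℕ → ℝ → E³ → E³} {w : ℝ → E³ → E³}
    (hvm : ∀ j, AEStronglyMeasurable (uncurry (v j))
      (volume.restrict (Iio (0 : ℝ) ×ˢ (univ : Set E³))))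
    (hum : AEStronglyMeasurable (uncurry w) (volume.restrict (Iio (0 : ℝ) ×ˢ (univ : Set E³))))
    (hconv : ∀ R : ℝ, 0 < R → Tendsto (fun j => eLpNorm (uncurry (v j) - uncurry w) 3
        (volume.restrict (parabolicCylinder R (0 : ℝ × E³)))) atTop (𝓝 0))
    (P : ℝ × E³ → Prop) (f : ℝ × E³ → E³ → ℝ) (b : ℝ × E³ → ℝ) (hf : ∀ z, Continuous (f z))
    (hb : ∀ z : ℝ × E³, z.1 < 0 → P z → ∀ᶠ j in atTop, f z (v j z.1 z.2) ≤ b z) :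
    ∀ᵐ z ∂(volume.restrict (Iio (0 : ℝ) ×ˢ (univ : Set E³))), P z → f z (w z.1 z.2) ≤ b z := by
  refine ae_restrict_of_ae_restrict_of_subset lowerHalf_subset_iUnion_parabolicCylinder ?_
  rw [ae_restrict_iUnion_iff]
  intro n
  set Q₀ : Set (ℝ × E³) := parabolicCylinder ((n : ℝ) + 1) (0 : ℝ × E³) with hQ₀
  have hQ₀s : Q₀ ⊆ Iio (0 : ℝ) ×ˢ (univ : Set E³) := parabolicCylinder_subset_lowerHalf le_rfl _
  have hvm' : ∀ j, AEStronglyMeasurable (uncurry (v j)) (volume.restrict Q₀) := fun j =>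
    (hvm j).mono_measure (Measure.restrict_mono hQ₀s le_rfl)
  have hum' : AEStronglyMeasurable (uncurry w) (volume.restrict Q₀) :=
    hum.mono_measure (Measure.restrict_mono hQ₀s le_rfl)
  have hTIM : TendstoInMeasure (volume.restrict Q₀) (fun j => uncurry (v j)) atTop (uncurry w) :=
    tendstoInMeasure_of_tendsto_eLpNorm (by norm_num) hvm' hum' (hconv _ (by positivity))
  obtain ⟨ns, hns, hae⟩ := hTIM.exists_seq_tendsto_ae
  filter_upwards [hae, ae_restrict_mem (isOpen_parabolicCylinder _ _).measurableSet]
    with z hz hzQ hP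
  have hz0 : z.1 < 0 := (hQ₀s hzQ).1
  have ht : Tendsto (fun i => f z (v (ns i) z.1 z.2)) atTop (𝓝 (f z (w z.1 z.2))) :=
    ((hf z).tendsto _).comp hz
  exact le_of_tendsto ht (hns.tendsto_atTop.eventually (hb z hz0 hP))

/-! ### The cone predicate and the three bounds under the zoom about the origin -/

/-- **The open cone `{x | κ ‖x‖ < ⟪x, e⟫}` is invariant under positive dilations**:
`κ ‖c • y‖ < ⟪c • y, e⟫ ↔ κ ‖y‖ < ⟪y, e⟫` for `0 < c`. [folklore] -/
private theorem coneZoom_mem_cone_smul_iff {κ c : ℝ} {e y : E³} (hc : 0 < c) :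
    κ * ‖c • y‖ < ⟪c • y, e⟫ ↔ κ * ‖y‖ < ⟪y, e⟫ := by
  rw [norm_smul, Real.norm_of_nonneg hc.le, real_inner_smul_left, mul_left_comm]
  exact mul_lt_mul_iff_right₀ hc

/-- **The rate bound is scale invariant**: `‖u_c(s, y)‖ ≤ C/√(−s)` (KNSS 2009, §1;
`HasTypeITimeDecay.nsRescale`). [cite: KNSS2009, §1] -/
private theorem coneZoom_rate {C c : ℝ} {u : ℝ → E³ → E³} (h : HasTypeITimeDecay C u)
    (hc : 0 < c) : HasTypeITimeDecay C (c • stPull (c ^ 2) c 0 (0 : E³) u) := by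
  rw [zoom_eq_nsRescale]
  exact h.nsRescale hc

/-- **The calm bound on a cone with vertex at the origin is scale invariant**: if
`‖u(t, x)‖ ≤ K/(‖x‖ + √(−t))` for `κ ‖x‖ < ⟪x, e⟫`, then the same holds for every zoom `u_c`,
`0 < c` (the region `{κ ‖x‖ < ⟪x, e⟫}` is a cone; KNSS 2009, (1.6) is scaling invariant).
[folklore] -/
private theorem coneZoom_calm {κ K c : ℝ} {e : E³} {u : ℝ → E³ → E³}
    (h : ∀ t : ℝ, t < 0 → ∀ x : E³, κ * ‖x‖ < ⟪x, e⟫ → ‖u t x‖ ≤ K / (‖x‖ + Real.sqrt (-t)))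
    (hc : 0 < c) :
    ∀ t : ℝ, t < 0 → ∀ x : E³, κ * ‖x‖ < ⟪x, e⟫ →
      ‖(c • stPull (c ^ 2) c 0 (0 : E³) u) t x‖ ≤ K / (‖x‖ + Real.sqrt (-t)) := by
  intro t ht x hx
  have hct : c ^ 2 * t < 0 := mul_neg_of_pos_of_neg (by positivity) ht
  have hcx : κ * ‖c • x‖ < ⟪c • x, e⟫ := (coneZoom_mem_cone_smul_iff hc).2 hx
  have key := h (c ^ 2 * t) hct (c • x) hcx
  rw [smul_stPull_apply, zero_add, zero_add, norm_smul, Real.norm_of_nonneg hc.le]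
  have hsq : Real.sqrt (-(c ^ 2 * t)) = c * Real.sqrt (-t) := by
    rw [show -(c ^ 2 * t) = c ^ 2 * -t by ring, Real.sqrt_mul (sq_nonneg c), Real.sqrt_sq hc.le]
  rw [norm_smul, Real.norm_of_nonneg hc.le, hsq, ← mul_add, div_mul_eq_div_div_swap] at key
  have hden : 0 < ‖x‖ + Real.sqrt (-t) :=
    add_pos_of_nonneg_of_pos (norm_nonneg _) (Real.sqrt_pos.2 (by linarith))
  calc c * ‖u (c ^ 2 * t) (c • x)‖ ≤ c * (K / (‖x‖ + Real.sqrt (-t)) / c) := by gcongr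
    _ = K / (‖x‖ + Real.sqrt (-t)) := by field_simp

/-- **The faint bound under the zoom**: if `‖x‖ ‖u(t, x)‖ ≤ ε` for `κ ‖x‖ < ⟪x, e⟫`, `‖x‖ < δ`,
`−η‖x‖² < t < 0`, then `‖y‖ ‖u_c(s, y)‖ ≤ ε` for `κ ‖y‖ < ⟪y, e⟫`, `c‖y‖ < δ`, `−η‖y‖² < s < 0`
(`‖y‖ ‖u_c(s, y)‖ = ‖c y‖ ‖u(c² s, c y)‖`). [folklore] -/
private theorem coneZoom_faint {κ ε δ η c : ℝ} {e : E³} {u : ℝ → E³ → E³}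
    (h : ∀ x : E³, κ * ‖x‖ < ⟪x, e⟫ → ‖x‖ < δ → ∀ t : ℝ, -η * ‖x‖ ^ 2 < t → t < 0 →
      ‖x‖ * ‖u t x‖ ≤ ε)
    (hc : 0 < c) {y : E³} (hy : κ * ‖y‖ < ⟪y, e⟫) (hyδ : c * ‖y‖ < δ) {s : ℝ}
    (hs : -η * ‖y‖ ^ 2 < s) (hs0 : s < 0) :
    ‖y‖ * ‖(c • stPull (c ^ 2) c 0 (0 : E³) u) s y‖ ≤ ε := by
  have hcs : c ^ 2 * s < 0 := mul_neg_of_pos_of_neg (by positivity) hs0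
  have hcy : κ * ‖c • y‖ < ⟪c • y, e⟫ := (coneZoom_mem_cone_smul_iff hc).2 hy
  have hny : ‖c • y‖ = c * ‖y‖ := by rw [norm_smul, Real.norm_of_nonneg hc.le]
  have hcyδ : ‖c • y‖ < δ := hny ▸ hyδ
  have hcs' : -η * ‖c • y‖ ^ 2 < c ^ 2 * s := by
    rw [hny, show -η * (c * ‖y‖) ^ 2 = c ^ 2 * (-η * ‖y‖ ^ 2) by ring]
    exact mul_lt_mul_of_pos_left hs (by positivity)
  have key := h (c • y) hcy hcyδ (c ^ 2 * s) hcs' hcs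
  rw [hny] at key
  rw [smul_stPull_apply, zero_add, zero_add, norm_smul, Real.norm_of_nonneg hc.le]
  calc ‖y‖ * (c * ‖u (c ^ 2 * s) (c • y)‖) = c * ‖y‖ * ‖u (c ^ 2 * s) (c • y)‖ := by ring
    _ ≤ ε := key

/-! ### S1c: the blow-up limit on a cone -/

/-- **S1c (stub_coneZoomLimit).** Blow-up at the space–time origin of a rate-Type-I slab
profile with `𝐈 < ⊤`, singular origin, calm and faint on the cone `{κ ‖x‖ < ⟪x, e⟫}`: along
dyadic scales the zooms `λ u(λ² s, λ y)` subconverge in `L³(Q(0,R))` (ENGINE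
`slab_typeI_compactness`) to a suitable weak slab solution `(w, π, H)` with `𝐈 < ⊤`, singular
origin (`zoom_isBackwardSingularPoint`), and the rate, the calm bound and the LIMIT of the faint
bound (`‖y‖‖w(s,y)‖ ≤ ε` on `{κ ‖y‖ < ⟪y,e⟫, −η(ε)‖y‖² < s < 0}`) almost everywhere (template:
`stub_halfspaceZoomLimit`, `RellichScarNoMildScar.exists_blowup_limit_apex`).
[cite: AlbrittonBarker2019, Lemma 2.2, Prop. 2.3 and §3] -/
theorem stub_coneZoomLimit :
    ∀ (κ C K : ℝ) (e : E³) (u : ℝ → E³ → E³) (p : ℝ → E³ → ℝ) (G : ℝ → E³ → E³ →L[ℝ] E³),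
      IsSuitableWeakSolutionOn 𝕊 1 0 u p → HasWeakSpatialGradientOn 𝕊 u G →
      typeIBound (Iio (0 : ℝ) ×ˢ univ) u p G < ⊤ → HasTypeITimeDecay C u → IsBackwardSingularPoint u 0 →
      (∀ t : ℝ, t < 0 → ∀ x : E³, κ * ‖x‖ < ⟪x, e⟫ → ‖u t x‖ ≤ K / (‖x‖ + Real.sqrt (-t))) →
      (∀ ε : ℝ, 0 < ε → ∃ δ : ℝ, 0 < δ ∧ ∃ η : ℝ, 0 < η ∧ ∀ x : E³, κ * ‖x‖ < ⟪x, e⟫ → ‖x‖ < δ →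
        ∀ t : ℝ, -η * ‖x‖ ^ 2 < t → t < 0 → ‖x‖ * ‖u t x‖ ≤ ε) →
      ∃ (w : ℝ → E³ → E³) (π : ℝ → E³ → ℝ) (H : ℝ → E³ → E³ →L[ℝ] E³),
        IsSuitableWeakSolutionOn 𝕊 1 0 w π ∧ HasWeakSpatialGradientOn 𝕊 w H ∧
        typeIBound (Iio (0 : ℝ) ×ˢ univ) w π H < ⊤ ∧ IsBackwardSingularPoint w 0 ∧
        (∀ᵐ z ∂(volume.restrict (Iio (0 : ℝ) ×ˢ (univ : Set E³))), ‖w z.1 z.2‖ ≤ C / Real.sqrt (-z.1)) ∧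
        (∀ᵐ z ∂(volume.restrict (Iio (0 : ℝ) ×ˢ (univ : Set E³))),
          κ * ‖z.2‖ < ⟪z.2, e⟫ → ‖w z.1 z.2‖ ≤ K / (‖z.2‖ + Real.sqrt (-z.1))) ∧
        (∀ ε : ℝ, 0 < ε → ∃ η : ℝ, 0 < η ∧ ∀ᵐ z ∂(volume.restrict (Iio (0 : ℝ) ×ˢ (univ : Set E³))),
          κ * ‖z.2‖ < ⟪z.2, e⟫ → -η * ‖z.2‖ ^ 2 < z.1 → ‖z.2‖ * ‖w z.1 z.2‖ ≤ ε) := by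
  intro κ C K e u p G hsw hwg hI hrate hsing hcalm hfaint
  obtain ⟨hlpos, -, hl0⟩ := dyadicScale_facts
  set lam : ℕ → ℝ := fun n => (1 / 2 : ℝ) ^ (n + 1) with hlam
  set I : ℝ≥0∞ := typeIBound (Iio (0 : ℝ) ×ˢ (univ : Set E³)) u p G with hIdef
  -- ## the zoomed family
  set v : ℕ → ℝ → E³ → E³ := fun k => lam k • stPull (lam k ^ 2) (lam k) 0 (0 : E³) u with hv
  set qk : ℕ → ℝ → E³ → ℝ := fun k => lam k ^ 2 • stPull (lam k ^ 2) (lam k) 0 (0 : E³) p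
    with hqk
  set Gk : ℕ → ℝ → E³ → E³ →L[ℝ] E³ :=
    fun k => lam k ^ 2 • stPull (lam k ^ 2) (lam k) 0 (0 : E³) G with hGk
  have hswk : ∀ k, IsSuitableWeakSolutionOn 𝕊 1 0 (v k) (qk k) :=
    fun k => zoom_isSuitableWeakSolutionOn_slab hsw (hlpos k)
  have hwgk : ∀ k, HasWeakSpatialGradientOn 𝕊 (v k) (Gk k) :=
    fun k => zoom_hasWeakSpatialGradientOn_slab hwg (hlpos k)
  have hbdk : ∀ k, typeIBound (Iio (0 : ℝ) ×ˢ univ) (v k) (qk k) (Gk k) ≤ I := fun k =>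
    (typeIBound_lowerHalf_nsZoom (hlpos k) u p G).le
  have hsingk : ∀ k, IsBackwardSingularPoint (v k) 0 := fun k =>
    zoom_isBackwardSingularPoint hsing (hlpos k)
  have hratek : ∀ k (z : ℝ × E³), z.1 < 0 → ‖v k z.1 z.2‖ ≤ C / Real.sqrt (-z.1) :=
    fun k z hz => coneZoom_rate hrate (hlpos k) z.1 hz z.2
  have hcalmk : ∀ k (z : ℝ × E³), z.1 < 0 → κ * ‖z.2‖ < ⟪z.2, e⟫ →
      ‖v k z.1 z.2‖ ≤ K / (‖z.2‖ + Real.sqrt (-z.1)) :=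
    fun k z hz hze => coneZoom_calm hcalm (hlpos k) z.1 hz z.2 hze
  -- ## the ENGINE
  obtain ⟨w, π, H, σ, hσ, hsww, hH, h4I, hconv, hpers⟩ :=
    slab_typeI_compactness I v qk Gk hI hswk hwgk hbdk
  -- ## the origin is a backward singular point of the limit
  have hsingw : IsBackwardSingularPoint w 0 := by
    refine hpers fun R hR => ?_
    have hc : (fun j => eLpNorm (uncurry (v (σ j))) ⊤
        (volume.restrict (parabolicCylinder R (0 : ℝ × E³)))) = fun _ => ⊤ := by
      funext j
      exact hsingk (σ j) R hR
    rw [hc]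
    exact limsup_const ⊤
  -- ## measurability along the subsequence, and its scales tend to zero
  have hvm : ∀ j, AEStronglyMeasurable (uncurry (v (σ j)))
      (volume.restrict (Iio (0 : ℝ) ×ˢ (univ : Set E³))) := fun j =>
    (hwgk (σ j)).locallyIntegrableOn.aestronglyMeasurable
  have hum : AEStronglyMeasurable (uncurry w) (volume.restrict (Iio (0 : ℝ) ×ˢ (univ : Set E³))) :=
    hH.locallyIntegrableOn.aestronglyMeasurable
  have hlσ0 : Tendsto (fun j => lam (σ j)) atTop (𝓝 0) := hl0.comp hσ.tendsto_atTop
  -- ## the rate bound passes to the a.e. limit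
  have hratew : ∀ᵐ z ∂(volume.restrict (Iio (0 : ℝ) ×ˢ (univ : Set E³))),
      ‖w z.1 z.2‖ ≤ C / Real.sqrt (-z.1) := by
    have h := coneZoom_ae_limit_bound hvm hum hconv (fun _ => True) (fun _ y => ‖y‖)
      (fun z => C / Real.sqrt (-z.1)) (fun _ => continuous_norm)
      (fun z hz _ => Eventually.of_forall fun j => hratek (σ j) z hz)
    filter_upwards [h] with z hz
    exact hz trivial
  -- ## the calm bound passes to the a.e. limit
  have hcalmw : ∀ᵐ z ∂(volume.restrict (Iio (0 : ℝ) ×ˢ (univ : Set E³))),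
      κ * ‖z.2‖ < ⟪z.2, e⟫ → ‖w z.1 z.2‖ ≤ K / (‖z.2‖ + Real.sqrt (-z.1)) :=
    coneZoom_ae_limit_bound hvm hum hconv (fun z => κ * ‖z.2‖ < ⟪z.2, e⟫) (fun _ y => ‖y‖)
      (fun z => K / (‖z.2‖ + Real.sqrt (-z.1))) (fun _ => continuous_norm)
      (fun z hz hze => Eventually.of_forall fun j => hcalmk (σ j) z hz hze)
  -- ## the faint bound passes to the a.e. limit in the limit form
  have hfaintw : ∀ ε : ℝ, 0 < ε → ∃ η : ℝ, 0 < η ∧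
      ∀ᵐ z ∂(volume.restrict (Iio (0 : ℝ) ×ˢ (univ : Set E³))),
        κ * ‖z.2‖ < ⟪z.2, e⟫ → -η * ‖z.2‖ ^ 2 < z.1 → ‖z.2‖ * ‖w z.1 z.2‖ ≤ ε := by
    intro ε hε
    obtain ⟨δ, hδ, η, hη, hfe⟩ := hfaint ε hε
    refine ⟨η, hη, ?_⟩
    have h := coneZoom_ae_limit_bound hvm hum hconv
      (fun z => κ * ‖z.2‖ < ⟪z.2, e⟫ ∧ -η * ‖z.2‖ ^ 2 < z.1) (fun z y => ‖z.2‖ * ‖y‖) (fun _ => ε)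
      (fun _ => continuous_const.mul continuous_norm) ?_
    · filter_upwards [h] with z hz hze hzη
      exact hz ⟨hze, hzη⟩
    · rintro z hz ⟨hze, hzη⟩
      -- eventually `λ_{σ j} ‖z.2‖ < δ`, since the scales tend to zero
      have hsmall : ∀ᶠ j in atTop, lam (σ j) * ‖z.2‖ < δ := by
        have ht : Tendsto (fun j => lam (σ j) * ‖z.2‖) atTop (𝓝 (0 * ‖z.2‖)) :=
          hlσ0.mul_const _
        rw [zero_mul] at ht
        exact ht.eventually (gt_mem_nhds hδ)
      filter_upwards [hsmall] with j hj
      exact coneZoom_faint hfe (hlpos (σ j)) hze hj hzη hz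
  -- ## conclusion
  have hIw : typeIBound (Iio (0 : ℝ) ×ˢ univ) w π H < ⊤ :=
    lt_of_le_of_lt h4I (ENNReal.mul_lt_top (by simp) hI)
  exact ⟨w, π, H, hsww, hH, hIw, hsingw, hratew, hcalmw, hfaintw⟩

end Summit.NavierStokesRegularity.NavierStokesRegularity.Theorems.RellichScarApexLocalisation

end
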